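import Mathlib.NumberTheory.LSeries.PrimesInAP
import Mathlib.Analysis.SpecialFunctions.Pow.Real
import Mathlib.Analysis.SpecialFunctions.Log.Basic
import HarnessLib

/-!
# Dirichlet's theorem in the reciprocal form: `∑_{p ≡ a (mod k)} 1/p` diverges

Source: P. G. L. Dirichlet, *Beweis des Satzes, dass jede unbegrenzte arithmetische Progression … unendlich
viele Primzahlen enthält*, Abh. Königl. Preuss. Akad. Wiss. (1837) 45–81 [Dirichlet1837]; in the textbook form
H. L. Montgomery, R. C. Vaughan, *Multiplicative Number Theory I: Classical Theory*, Cambridge Stud. Adv. Math. 97,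
CUP (2007), doi:10.1017/CBO9780511618314 [MontgomeryVaughan2007], Corollary 4.12 (c), p. 90:
"`∑_{p ≤ x, p ≡ a (q)} 1/p = φ(q)⁻¹ log log x + b(q,a) + O_q(1/log x)`" for `(a,q) = 1`, `x ≥ 2` — of which this file
proves the qualitative consequence: the series of reciprocals of the primes in a reduced residue class diverges.

What is proved (`Literature.NumberTheory.LFunctions.not_summable_one_div_on_primes_in_residueClass`): for `k ≥ 1`
and `a` coprime to `k`, `¬ Summable ({p prime, p % k = a % k}.indicator (1/·))`; and the `ZMod` dress
`not_summable_one_div_on_primes_eq_mod` (the shape of Mathlib's `Nat.setOf_prime_and_eq_mod_infinite`).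

Design.  Mathlib (v4.32.0) records Dirichlet's theorem as infinitude (`Nat.setOf_prime_and_eq_mod_infinite`) and
as the divergence of the `Λ(p)/p`-WEIGHTED series over the class
(`ArithmeticFunction.vonMangoldt.not_summable_residueClass_prime_div`), which does not imply the `1/p` form
(`1/p ≤ log p / p`).  It does contain the quantitative input
`ArithmeticFunction.vonMangoldt.LSeries_residueClass_lower_bound`: `∑_n Λ_a(n) n^{-x} ≥ φ(k)⁻¹/(x−1) − C` on
`x ∈ (1,2]`.  The passage to `1/p` is the elementary estimate `log p / p^x ≤ 1/((x−1) p)` (`log_div_rpow_le`)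
applied to a tail of a putatively convergent `∑ 1/p`: the tail would contribute at most `c/(x−1)` with
`c < φ(k)⁻¹/2`, the non-prime prime powers and a finite head contribute `O(1)`, and letting `x → 1⁺` contradicts the
lower bound.  Mathlib + `HarnessLib` (tags) only; standard axioms.

Provenance: written 2026-08-18 for the refutations bundle (`papers/_cross/refutations`), where it discharges the
analytic hypothesis `DirichletReciprocalDivergence` of the Corrádi–Kátai (1969) counterexample
(`Literature.NumberTheory.Multiplicative.CorradiKatai1969`); moved into the tree under the Lean-in-tree rule.

NOT here: the asymptotic `log log x` law itself, the constant `b(q,a)`, Mertens' product form (Cor. 4.12 (d)).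
-/

open ArithmeticFunction Filter Topology

namespace Literature.NumberTheory.LFunctions

/-- Elementary: for `x > 1` and `n ≥ 1`, `log n / n^x ≤ (x-1)⁻¹ · (1/n)` (from `log n ≤ n^{x-1}/(x-1)`,
Mathlib's `Real.log_le_rpow_div`). [folklore] -/
theorem log_div_rpow_le {n : ℕ} (hn : 0 < n) {x : ℝ} (hx : 1 < x) :
    Real.log n / (n : ℝ) ^ x ≤ (x - 1)⁻¹ * (1 / (n : ℝ)) := by
  have hn' : (0 : ℝ) < n := by exact_mod_cast hn
  have hnx : (0 : ℝ) < (n : ℝ) ^ x := Real.rpow_pos_of_pos hn' x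
  have h1 : Real.log n ≤ (n : ℝ) ^ (x - 1) / (x - 1) := Real.log_le_rpow_div hn'.le (by linarith)
  have h2 : (n : ℝ) ^ (x - 1) = (n : ℝ) ^ x / n := Real.rpow_sub_one hn'.ne' x
  rw [div_le_iff₀ hnx]
  calc Real.log n ≤ (n : ℝ) ^ (x - 1) / (x - 1) := h1
    _ = (x - 1)⁻¹ * (1 / (n : ℝ)) * (n : ℝ) ^ x := by rw [h2]; ring

/-- **Dirichlet (1837), reciprocal form** (Montgomery–Vaughan Cor. 4.12 (c), qualitative consequence). For `k ≥ 1`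
and `a` coprime to `k`, the series `∑ 1/p` over the primes `p ≡ a (mod k)` diverges:
`¬ Summable ({p | p.Prime ∧ p % k = a % k}.indicator fun n => 1/n)`.
[cite: MontgomeryVaughan2007, Cor. 4.12 (c)] -/
theorem not_summable_one_div_on_primes_in_residueClass (k a : ℕ) (hk : 0 < k) (hak : Nat.Coprime a k) :
    ¬ Summable (Set.indicator {p : ℕ | p.Prime ∧ p % k = a % k} fun n => (1 : ℝ) / n) := by
  intro hS
  haveI : NeZero k := ⟨hk.ne'⟩
  set S : Set ℕ := {p : ℕ | p.Prime ∧ p % k = a % k} with hSdef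
  set g : ℕ → ℝ := Set.indicator S fun n => (1 : ℝ) / n with hgdef
  have hg0 : ∀ n, 0 ≤ g n := fun n => Set.indicator_apply_nonneg fun _ => by positivity
  set a' : ZMod k := (a : ZMod k) with ha'def
  have ha' : IsUnit a' := (ZMod.isUnit_iff_coprime a k).mpr hak
  obtain ⟨C, hC⟩ := ArithmeticFunction.vonMangoldt.LSeries_residueClass_lower_bound ha'
  -- the constant `c = φ(k)⁻¹ / 2 > 0`
  have hφ : 0 < ((k.totient : ℕ) : ℝ)⁻¹ := inv_pos.mpr (by exact_mod_cast Nat.totient_pos.mpr hk)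
  set c : ℝ := ((k.totient : ℕ) : ℝ)⁻¹ / 2 with hcdef
  have hc : 0 < c := by positivity
  -- a tail of `g` with sum `< c`
  obtain ⟨N, hN⟩ : ∃ N : ℕ, ∑' n, g (n + N) < c :=
    (((tendsto_order.1 (tendsto_sum_nat_add g)).2 c hc)).exists
  set v : ℕ → ℝ := fun n => if N ≤ n then g n else 0 with hvdef
  have hv0 : ∀ n, 0 ≤ v n := fun n => by simp only [hvdef]; split_ifs <;> simp [hg0]
  have hvle : ∀ n, v n ≤ g n := fun n => by simp only [hvdef]; split_ifs <;> simp [hg0]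
  have hv : Summable v := hS.of_nonneg_of_le hv0 hvle
  have hTv : ∑' n, v n < c := by
    have h1 := hv.sum_add_tsum_nat_add N
    have h2 : ∑ i ∈ Finset.range N, v i = 0 :=
      Finset.sum_eq_zero fun i hi => by simp [hvdef, Finset.mem_range.mp hi]
    have h3 : ∑' n, v (n + N) = ∑' n, g (n + N) := tsum_congr fun n => by simp [hvdef]
    linarith
  -- the non-prime part (Mathlib) and the finite head
  set w : ℕ → ℝ := fun n => (if n.Prime then 0 else vonMangoldt.residueClass a' n) / n with hwdef
  have hw : Summable w := vonMangoldt.summable_residueClass_non_primes_div a'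
  have hw0 : ∀ n, 0 ≤ w n := fun n => by
    simp only [hwdef]; positivity [vonMangoldt.residueClass_nonneg a' n]
  set h : ℕ → ℝ := fun n => if n < N then Λ n else 0 with hhdef
  have hh : Summable h := summable_of_ne_finset_zero (s := Finset.range N) fun n hn => by
    simp only [hhdef, Finset.mem_range] at hn ⊢; simp [hn]
  have hh0 : ∀ n, 0 ≤ h n := fun n => by
    simp only [hhdef]; split_ifs <;> simp [vonMangoldt_nonneg]
  -- termwise domination
  have key : ∀ {x : ℝ}, x ∈ Set.Ioc (1 : ℝ) 2 → ∀ n : ℕ,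
      vonMangoldt.residueClass a' n / (n : ℝ) ^ x ≤ w n + h n + (x - 1)⁻¹ * v n := by
    intro x hx n
    have hx1 : 1 < x := hx.1
    have hxi : 0 ≤ (x - 1)⁻¹ := inv_nonneg.mpr (by linarith)
    have hextra : 0 ≤ h n + (x - 1)⁻¹ * v n := add_nonneg (hh0 n) (mul_nonneg hxi (hv0 n))
    by_cases hp : n.Prime
    · have hn : 0 < n := hp.pos
      have hn' : (0 : ℝ) < n := by exact_mod_cast hn
      by_cases hcl : (n : ZMod k) = a'
      · -- prime in the class: residueClass = Λ n = log n
        have hrc : vonMangoldt.residueClass a' n = Λ n := by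
          simp [vonMangoldt.residueClass, Set.indicator_of_mem (show n ∈ {m : ℕ | (m : ZMod k) = a'} from hcl)]
        by_cases hnN : n < N
        · have hhn : h n = Λ n := by simp [hhdef, hnN]
          have h1 : (1 : ℝ) ≤ (n : ℝ) ^ x := Real.one_le_rpow (by exact_mod_cast hn) (by linarith)
          have : Λ n / (n : ℝ) ^ x ≤ Λ n := div_le_self vonMangoldt_nonneg h1
          rw [hrc]; linarith [hw0 n, mul_nonneg hxi (hv0 n)]
        · have hmem : n ∈ S := by
            refine ⟨hp, ?_⟩
            exact (ZMod.natCast_eq_natCast_iff' n a k).mp hcl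
          have hvn : v n = 1 / (n : ℝ) := by
            simp [hvdef, not_lt.mp hnN, hgdef, Set.indicator_of_mem hmem]
          have := log_div_rpow_le hn hx1
          rw [hrc, vonMangoldt_apply_prime hp, hvn]
          linarith [hw0 n, hh0 n]
      · have hrc : vonMangoldt.residueClass a' n = 0 := by
          simp [vonMangoldt.residueClass, Set.indicator_of_notMem (show n ∉ {m : ℕ | (m : ZMod k) = a'} from hcl)]
        rw [hrc, zero_div]; linarith [hw0 n]
    · -- non-prime: compare with `w n = residueClass a' n / n`
      have hwn : w n = vonMangoldt.residueClass a' n / n := by simp [hwdef, hp]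
      have hle : vonMangoldt.residueClass a' n / (n : ℝ) ^ x ≤ vonMangoldt.residueClass a' n / n := by
        rcases n.eq_zero_or_pos with rfl | hn
        · simp
        · refine div_le_div_of_nonneg_left (vonMangoldt.residueClass_nonneg a' _) (by exact_mod_cast hn) ?_
          conv_lhs => rw [← Real.rpow_one n]
          exact Real.rpow_le_rpow_of_exponent_le (by exact_mod_cast hn) hx1.le
      rw [hwn]; linarith
  -- summing up: for every x ∈ (1,2], c/(x-1) ≤ K
  set K : ℝ := C + ∑' n, w n + ∑' n, h n with hKdef
  have bound : ∀ {x : ℝ}, x ∈ Set.Ioc (1 : ℝ) 2 → c / (x - 1) ≤ K := by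
    intro x hx
    have hx1 : 0 < x - 1 := by linarith [hx.1]
    have hxi : 0 ≤ (x - 1)⁻¹ := inv_nonneg.mpr hx1.le
    have hR : Summable fun n => w n + h n + (x - 1)⁻¹ * v n := (hw.add hh).add (hv.mul_left _)
    have hRsum : ∑' n, (w n + h n + (x - 1)⁻¹ * v n) = ∑' n, w n + ∑' n, h n + (x - 1)⁻¹ * ∑' n, v n := by
      rw [(hw.add hh).tsum_add (hv.mul_left _), hw.tsum_add hh, tsum_mul_left]
    have hRnonneg : 0 ≤ ∑' n, w n + ∑' n, h n + (x - 1)⁻¹ * ∑' n, v n :=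
      add_nonneg (add_nonneg (tsum_nonneg hw0) (tsum_nonneg hh0)) (mul_nonneg hxi (tsum_nonneg hv0))
    have hL : ∑' n, vonMangoldt.residueClass a' n / (n : ℝ) ^ x
        ≤ ∑' n, w n + ∑' n, h n + (x - 1)⁻¹ * ∑' n, v n := by
      by_cases hsum : Summable fun n => vonMangoldt.residueClass a' n / (n : ℝ) ^ x
      · rw [← hRsum]; exact hsum.tsum_le_tsum (key hx) hR
      · rw [tsum_eq_zero_of_not_summable hsum]; exact hRnonneg
    have hlow := hC hx
    -- φ⁻¹/(x-1) - C ≤ W + H + (x-1)⁻¹ T with T < c = φ⁻¹/2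
    have hT := hTv
    have e1 : ((k.totient : ℕ) : ℝ)⁻¹ / (x - 1) = 2 * c * (x - 1)⁻¹ := by
      rw [hcdef]; field_simp
    have e2 : c / (x - 1) = c * (x - 1)⁻¹ := div_eq_mul_inv _ _
    have h3 : (x - 1)⁻¹ * ∑' n, v n ≤ c * (x - 1)⁻¹ := by
      rw [mul_comm]; exact mul_le_mul_of_nonneg_right hT.le hxi
    rw [e2]; rw [e1] at hlow
    nlinarith [hlow, hL, h3, mul_nonneg hc.le hxi]
  -- contradiction: x = 2 gives c ≤ K, then x = 1 + c/(2K) gives 2K ≤ K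
  have hK : c ≤ K := by
    have := bound (x := 2) ⟨by norm_num, le_rfl⟩
    norm_num at this
    exact this
  have hKpos : 0 < K := hc.trans_le hK
  have hx' : (1 : ℝ) + c / (2 * K) ∈ Set.Ioc (1 : ℝ) 2 := by
    constructor
    · have : 0 < c / (2 * K) := by positivity
      linarith
    · have : c / (2 * K) ≤ 1 := by
        rw [div_le_one (by positivity)]; linarith
      linarith
  have h2K := bound hx'
  have : c / (1 + c / (2 * K) - 1) = 2 * K := by
    rw [show (1 : ℝ) + c / (2 * K) - 1 = c / (2 * K) by ring, div_div_eq_mul_div, mul_div_cancel_left₀ _ hc.ne']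
  rw [this] at h2K
  linarith

/-- The same in `ZMod` dress (the shape of Mathlib's `Nat.setOf_prime_and_eq_mod_infinite`): for `q ≥ 1` and a unit
`a : ZMod q`, `∑ 1/p` over the primes `p` with `(p : ZMod q) = a` diverges.
[cite: MontgomeryVaughan2007, Cor. 4.12 (c)] -/
theorem not_summable_one_div_on_primes_eq_mod {q : ℕ} [NeZero q] {a : ZMod q} (ha : IsUnit a) :
    ¬ Summable (Set.indicator {p : ℕ | p.Prime ∧ (p : ZMod q) = a} fun n => (1 : ℝ) / n) := by
  have hq : 0 < q := Nat.pos_of_ne_zero (NeZero.ne q)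
  have hav : ((a.val : ℕ) : ZMod q) = a := ZMod.natCast_zmod_val a
  have hcop : Nat.Coprime a.val q := by
    rw [← ZMod.isUnit_iff_coprime, hav]; exact ha
  have hset : {p : ℕ | p.Prime ∧ (p : ZMod q) = a} = {p : ℕ | p.Prime ∧ p % q = a.val % q} := by
    ext p
    simp only [Set.mem_setOf_eq]
    rw [← ZMod.natCast_eq_natCast_iff', hav]
  rw [hset]
  exact not_summable_one_div_on_primes_in_residueClass q a.val hq hcop

end Literature.NumberTheory.LFunctions
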